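import Literature.NumberTheory.EllipticCurves.BigRepModuleShiftedCokernelFiniteProofs
import Literature.NumberTheory.GaloisRepresentations.HOneUnramifiedFiniteKernelProofs
import HarnessLib

/-!
# On the big representation `M = bigRep κ ρ`, the unramified classes `ker(H¹(G, M) → H¹(N, M))` are
# FINITE when `A^N` is finite, `κ(N) = 1` and `κ(ψ) ≠ 0` for a `ψ` with `N·⟨ψ⟩` dense in `G`
# (step (S2) of the finitely decomposed local term, in the case of finite inertia invariants)

Topic `NumberTheory/EllipticCurves`; namespace `Literature.NumberTheory.EllipticCurves.BigGaloisRep`.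
THEOREMS ONLY (no definition, no named fact, no `sorry`). Cell `bsd-stepL`, K2 support 20495
`JSWSigmaLocalCharIdeal` (module L5 of the discharge plan, `HOME/imc-p1/g13/L5-PLAN`); seat
`bsd-stepL-imc-p1` g13.

Setting: `G` a topological group, `κ : G →ₜ* ℤ_p`, `ρ` a continuous `𝒪`-linear representation on a
discrete `A`, `M = bigRep κ ρ` (co-induced model `C^∞(ℤ_p, A)`, `(g·Φ)(x) = ρ(g)(Φ(x − κ g))`), `N ⊴ G` with
`κ(N) = 1` (e.g. the inertia group at `w ∤ p`: `ℤ_p`-extensions are unramified there) and `ψ ∈ G` with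
`N·⟨ψ⟩` dense (a Frobenius lift) and `κ(ψ) = c ≠ 0` (FINITELY DECOMPOSED place).

* `mem_invariantsOf_bigRep_iff` — `Φ ∈ M^N ↔ Φ` takes values in `A^N`;
* `finite_quotient_invariantsOf_bigRep` — `M^N/(ψ − 1)M^N` is finite when `A^N` is finite: `M^N` is the
  image of `C^∞(ℤ_p, A^N)` (`mapRange` of the inclusion), on which `ψ − 1` is the shifted endomorphism
  minus the identity, of finite cokernel (`BigRepModule.finite_quotient_range_shift_sub_id`);
* **`finite_setOf_resSubgroup_bigRep_eq_zero`** — hence `{c ∈ H¹(G, M) | res_N c = 0}` is finite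
  (`finite_setOf_resSubgroup_eq_zero_of_finite_coinvariants`, Serre *Local Fields* XIII §1).

With `Literature.NumberTheory.EllipticCurves.moduleFinite_isTorsion_mem_charIdeal_dual_h1_of_finite_ker_res`
(the Greenberg–Vatsal frame) this discharges hypothesis (S2) at every finitely decomposed place where
`E[p^∞]^{I_w}` is finite (additive reduction); the remaining input there is the submodule
`L' = H¹(I_w, M)^{D_w/I_w}` (S3).

References: [GreenbergVatsal2000] Prop. 2.4; [SerreLocalFields1979] XIII §1 Prop. 1; [Castella2018] §2.1;
[SkinnerUrban2014] §3.1.3, Prop. 3.2.3.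
-/

noncomputable section

open scoped Classical Pointwise

open CategoryTheory

universe u

namespace Literature.NumberTheory.EllipticCurves.BigGaloisRep

open Literature.NumberTheory.GaloisRepresentations BigRepModule _root_.Subgroup

variable {𝒪 : Type u} [CommRing 𝒪] [TopologicalSpace 𝒪] {p : ℕ} [Fact p.Prime]
variable {G : Type u} [Group G] [TopologicalSpace G] [IsTopologicalGroup G]
variable {A : Type u} [AddCommGroup A] [Module 𝒪 A] [TopologicalSpace A] [DiscreteTopology A]
variable [TopologicalSpace (PowerSeries 𝒪)]
  [ContinuousSMul (PowerSeries 𝒪) (BigRepModule 𝒪 p A)]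
variable (κ : G →ₜ* Multiplicative ℤ_[p]) (ρ : ContinuousRep G 𝒪 A) (N : Subgroup G) [N.Normal]

omit [ContinuousSMul (PowerSeries 𝒪) (BigRepModule 𝒪 p A)] [N.Normal] in
/-- **`Φ ∈ M^N ↔ Φ` is `A^N`-valued** when `κ(N) = 1` (`(n·Φ)(x) = ρ(n)(Φ(x))` for `n ∈ N`).
[cite: SkinnerUrban2014, §3.1.3 (the co-induced model)] -/
theorem mem_invariantsOf_bigRep_iff (hκN : ∀ n ∈ N, κ n = 1) (Φ : BigRepModule 𝒪 p A) :
    Φ ∈ (bigRep κ ρ).invariantsOf N ↔ ∀ x, Φ x ∈ ρ.invariantsOf N := by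
  rw [ContinuousRep.mem_invariantsOf_iff]
  simp_rw [ContinuousRep.mem_invariantsOf_iff]
  constructor
  · intro hΦ x n
    have h := congrArg (fun Ψ : BigRepModule 𝒪 p A => Ψ x) (hΦ n)
    have hn : (κ (n : G)).toAdd = 0 := by rw [hκN n n.2]; rfl
    simp only [bigRep_apply_apply, hn, sub_zero] at h
    exact h
  · intro hΦ n
    ext x
    have hn : (κ (n : G)).toAdd = 0 := by rw [hκN n n.2]; rfl
    rw [bigRep_apply_apply, hn, sub_zero]
    exact hΦ x n

/-- `(ψ − 1)` preserves `M^N` (`N` normal: `n·ψ v = ψ·(ψ⁻¹nψ) v`; the `G/N`-module structure of the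
`N`-invariants). [cite: SerreGaloisCohomology1997, I §2.6 (the `G/H`-module `A^H`)] -/
theorem sub_mem_invariantsOf_bigRep (ψ : G) (Φ : BigRepModule 𝒪 p A)
    (hΦ : Φ ∈ (bigRep κ ρ).invariantsOf N) :
    (((bigRep κ ρ).toTopRep.ρ ψ).toLinearMap - LinearMap.id :
      (BigRepModule 𝒪 p A) →ₗ[PowerSeries 𝒪] BigRepModule 𝒪 p A) Φ ∈ (bigRep κ ρ).invariantsOf N := by
  rw [ContinuousRep.mem_invariantsOf_iff] at hΦ ⊢
  intro n
  change bigRep κ ρ (n : G) (bigRep κ ρ ψ Φ - Φ) = bigRep κ ρ ψ Φ - Φ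
  have hn' : ψ⁻¹ * (n : G) * ψ ∈ N := Subgroup.Normal.conj_mem' inferInstance (n : G) n.2 ψ
  have h2 : bigRep κ ρ (ψ⁻¹ * (n : G) * ψ) Φ = Φ := hΦ ⟨_, hn'⟩
  have h1 : bigRep κ ρ (n : G) (bigRep κ ρ ψ Φ) = bigRep κ ρ ψ Φ := by
    have e : (n : G) * ψ = ψ * (ψ⁻¹ * (n : G) * ψ) := by group
    rw [← Module.End.mul_apply, ← map_mul, e, map_mul, Module.End.mul_apply, h2]
  rw [map_sub, h1, hΦ n]

/-- **`M^N/(ψ − 1)M^N` is finite** when `A^N` is finite, `κ(N) = 1` and `κ(ψ) ≠ 0`: along the `𝒪`-linear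
bijection `C^∞(ℤ_p, A^N) ≅ M^N` (`mapRange` of `A^N ↪ A`), `ψ − 1` is the shifted endomorphism
`Φ ↦ ρ(ψ)(Φ(· − κψ)) − Φ`, of finite cokernel (`BigRepModule.finite_quotient_range_shift_sub_id`).
[cite: GreenbergVatsal2000, Prop. 2.4] [cite: SerreLocalFields1979, XIII §1] -/
theorem finite_quotient_invariantsOf_bigRep (hκN : ∀ n ∈ N, κ n = 1) {ψ : G}
    (hψ : (κ ψ).toAdd ≠ 0) [Finite (ρ.invariantsOf N)] :
    Finite ((bigRep κ ρ).invariantsOf N ⧸ LinearMap.range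
      ((((bigRep κ ρ).toTopRep.ρ ψ).toLinearMap - LinearMap.id :
        (BigRepModule 𝒪 p A) →ₗ[PowerSeries 𝒪] BigRepModule 𝒪 p A).restrict
        (sub_mem_invariantsOf_bigRep κ ρ N ψ))) := by
  -- `ρ(ψ)` restricted to `A^N`
  have hst : ∀ a ∈ ρ.invariantsOf N, ρ ψ a ∈ ρ.invariantsOf N := by
    intro a ha
    rw [ContinuousRep.mem_invariantsOf_iff] at ha ⊢
    intro n
    have hn' : ψ⁻¹ * (n : G) * ψ ∈ N := Subgroup.Normal.conj_mem' inferInstance (n : G) n.2 ψ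
    have h2 : ρ (ψ⁻¹ * (n : G) * ψ) a = a := ha ⟨_, hn'⟩
    have e : (n : G) * ψ = ψ * (ψ⁻¹ * (n : G) * ψ) := by group
    rw [← Module.End.mul_apply, ← map_mul, e, map_mul, Module.End.mul_apply, h2]
  set F : ρ.invariantsOf N →ₗ[𝒪] ρ.invariantsOf N := (ρ ψ).restrict hst with hF
  set c : ℤ_[p] := (κ ψ).toAdd with hc
  haveI hfin := BigRepModule.finite_quotient_range_shift_sub_id (p := p) F hψ
  -- the comparison `e : C^∞(ℤ_p, A^N) → M` (semilinear over `C : 𝒪 → Λ`), onto `M^N`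
  set V := (bigRep κ ρ).invariantsOf N with hV
  set T : (BigRepModule 𝒪 p A) →ₗ[PowerSeries 𝒪] BigRepModule 𝒪 p A :=
    ((bigRep κ ρ).toTopRep.ρ ψ).toLinearMap - LinearMap.id with hT
  have hTapply : ∀ (Ψ : BigRepModule 𝒪 p A) (x : ℤ_[p]), T Ψ x = ρ ψ (Ψ (x - c)) - Ψ x := fun Ψ x => rfl
  let e : BigRepModule 𝒪 p (ρ.invariantsOf N) →ₛₗ[(PowerSeries.C : 𝒪 →+* PowerSeries 𝒪)] V :=
    { toFun := fun Φ => ⟨mapRange (ρ.invariantsOf N).subtype Φ,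
        (mem_invariantsOf_bigRep_iff κ ρ N hκN _).mpr fun x => (Φ x).2⟩
      map_add' := fun Φ Ψ => Subtype.ext (map_add _ Φ Ψ)
      map_smul' := fun a Φ => Subtype.ext (by
        change mapRange (ρ.invariantsOf N).subtype (a • Φ) = (PowerSeries.C a) • mapRange _ Φ
        rw [map_smul, C_smul]) }
  have he_apply : ∀ Φ x, ((e Φ : V) : BigRepModule 𝒪 p A) x = ((Φ x : ρ.invariantsOf N) : A) :=
    fun _ _ => rfl
  have he_surj : ∀ v : V, ∃ Φ, e Φ = v := by
    intro v
    have hv : ∀ x, (v : BigRepModule 𝒪 p A) x ∈ ρ.invariantsOf N :=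
      (mem_invariantsOf_bigRep_iff κ ρ N hκN _).mp v.2
    obtain ⟨n, hn⟩ := (v : BigRepModule 𝒪 p A).exists_level
    obtain ⟨k, hk⟩ := (v : BigRepModule 𝒪 p A).exists_torsion
    refine ⟨BigRepModule.mk (fun x => ⟨(v : BigRepModule 𝒪 p A) x, hv x⟩)
      ⟨⟨n, fun x y hxy => Subtype.ext (hn x y hxy)⟩, ⟨k, fun x => Subtype.ext (by
        simpa using hk x)⟩⟩, ?_⟩
    exact Subtype.ext (BigRepModule.ext fun x => rfl)
  -- `e` intertwines the shifted endomorphism minus `1` with `T|_V`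
  set T' : BigRepModule 𝒪 p (ρ.invariantsOf N) →ₗ[𝒪] BigRepModule 𝒪 p (ρ.invariantsOf N) :=
    (mapRange (p := p) F).comp (translate (-c)) - LinearMap.id with hT'
  have hcomm : ∀ Φ, e (T' Φ) = (T.restrict (sub_mem_invariantsOf_bigRep κ ρ N ψ)) (e Φ) := by
    intro Φ
    apply Subtype.ext
    apply BigRepModule.ext
    intro x
    change (((F (Φ (x + -c)) - Φ x : ρ.invariantsOf N)) : A) = ρ ψ ((mapRange (ρ.invariantsOf N).subtype Φ) (x - c)) -
      (mapRange (ρ.invariantsOf N).subtype Φ) x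
    rw [← sub_eq_add_neg]
    rfl
  -- the induced surjection on quotients
  refine Finite.of_surjective
    (Submodule.mapQ (LinearMap.range T') (LinearMap.range (T.restrict (sub_mem_invariantsOf_bigRep κ ρ N ψ)))
      e fun Φ hΦ => ?_) fun q => ?_
  · obtain ⟨Ψ, rfl⟩ := LinearMap.mem_range.mp hΦ
    exact LinearMap.mem_range.mpr ⟨e Ψ, (hcomm Ψ).symm⟩
  · obtain ⟨v, rfl⟩ := Submodule.mkQ_surjective _ q
    obtain ⟨Φ, rfl⟩ := he_surj v
    exact ⟨Submodule.Quotient.mk Φ, rfl⟩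

/-- **The unramified classes of the big representation are finite at a finitely decomposed place with
finite inertia invariants**: for `M = bigRep κ ρ`, `N ⊴ G` with `κ(N) = 1`, `ψ` with `N·⟨ψ⟩` dense and
`κ(ψ) ≠ 0`, and `A^N` finite, the set `{c ∈ H¹(G, M) | res_N c = 0}` is finite (injection into
`M^N/(ψ − 1)M^N`, Serre XIII §1). [cite: GreenbergVatsal2000, Prop. 2.4] [cite: SerreLocalFields1979, XIII §1 Prop. 1] -/
theorem finite_setOf_resSubgroup_bigRep_eq_zero (hκN : ∀ n ∈ N, κ n = 1) {ψ : G}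
    (hψ : (κ ψ).toAdd ≠ 0) (hdense : Dense ((N : Set G) * (zpowers ψ : Set G)))
    [Finite (ρ.invariantsOf N)] :
    Set.Finite {c : continuousCohomology 1 (bigRep κ ρ).toTopRep |
      resSubgroup (bigRep κ ρ).toTopRep N 1 c = 0} := by
  haveI := finite_quotient_invariantsOf_bigRep κ ρ N hκN hψ
  exact finite_setOf_resSubgroup_eq_zero_of_finite_coinvariants (bigRep κ ρ).toTopRep
    (bigRep κ ρ).continuous_smul hdense ((bigRep κ ρ).invariantsOf N) (fun _ => Iff.rfl)
    (sub_mem_invariantsOf_bigRep κ ρ N ψ)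

end Literature.NumberTheory.EllipticCurves.BigGaloisRep

end
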